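import Summits.Ventures.HSemireg.WedgeHankelRecurrenceModule
import Summits.Ventures.HSemireg.WedgeHankelDivisorGeneric
import Summits.Ventures.HSemireg.WedgeHankelKernelColumnSpaceDivisors

/-!
# Venture HSemireg — GENERALISED PRONY: THE MINIMAL RECURRENCE OF A DIVISOR CLASS IS ITS DIVISOR POLYNOMIAL — for distinct nodes `λ_i` carrying sequences `q_i` of exact
# orders `P_i` (`D = Σ_i (P_i + 1)`), **inside the window `D + k ≤ N + 1` the recurrences of window `k + 1` of `Σ_i expMul λ_i q_i` are exactly the multiples of
# `Π_i (X − λ_i)^{P_i + 1}` of degree `≤ k`**; `Rec_D = K · Π_i (X − λ_i)^{P_i+1}` (`2D ≤ N + 1`): THE NODES ARE THE ROOTS AND THE ORDERS ARE THE ROOT MULTIPLICITIES (−1) of the minimal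
# recurrence; the mechanism is the SHIFT INTERTWINER `⟪(X − λ)·p, expMul λ q⟫_s = ⟪p, expMul λ (σq)⟫_s` and N18's product law

HONEST FRAMING. Part of the Lean index of the computation cell `pub-hsemireg` (seat p10 gen 26, Sunday typer «UNIFORM-IN-n»).
LINEAR ALGEBRA OF HANKEL (catalecticant) MATRICES and of polynomials over a field ONLY: no variety, no cohomology theory, no sheaf, no Ext group and no semiregularity map is constructed
here; nothing here says that HC / HC_CM / HC_AV holds; no Literature fact is declared or used.  Custodian versions as in `WedgeHankelSiegelIdeal` (1/3); the dictionary (`expMul λ q` = the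
coefficient sequence of `exp(λΘ)·v`, `v = Σ q_j Θ^j/j!` of order `P`; `Σ_i expMul λ_i q_i` = a DIVISOR CLASS `Σ_i exp(λ_i Θ) v_i` with divisor `Σ_i (P_i + 1)[λ_i]` on the rational normal
curve; a recurrence = a left-kernel vector of `H_k(q)`) is QUOTED, never asserted.

WHAT IS IN THE TREE / KEYED.  N18 (`WedgeHankelRecurrenceModule`, № 173): `hkFun`, `recSpace`, `hkFun_X_mul`, `hkFun_add_seq`, `hkFun_smul_seq`, `mul_mem_recSpace_add_seq` (the product
law), `finrank_recSpace_add_rank`, `finrank_recSpace_self`, `recSpace_eq_map_mulRight`; gen 15's `HankelFrameChange.expMul` / `shift_expMul` (the Pascal recursion), th-7's `Hankel.shift`;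
F2a (`WedgeHankelDivisorGeneric` / `WedgeHankelDivisorRank`, tree) THE DIVISOR RANK LAW `rank_hankel1_expMul_sum_eq_min` (`D ≤ N + 1 − k ⇒ rank H_k(Σ_i expMul λ_i q_i) = min(D, k + 1)`);
N7 (`WedgeHankelKernelColumnSpaceDivisors`, tree) `sum_expMul_eq`.
Mathlib: `Polynomial.roots_prod`, `roots_pow`, `roots_X_sub_C`, `roots_smul_nonzero`, `count_roots`, `Monic.natDegree_pow`.
THIS FILE (namespace `Summit.Ventures.HSemireg.Wedge.HankelOuter` continued; CHAINED on N18; 0 definitions):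
* §472 `hkFun_zero_seq`, `hkFun_shift_seq` (`⟪p, σq⟫_s = ⟪p, q⟫_{s+1}`), `hkFun_X_sub_C_mul` (`⟪(X − λ)p, q⟫_s = ⟪p, q⟫_{s+1} − λ⟪p, q⟫_s`), `expMul_shift_eq` (`expMul λ (σq) = σ(expMul λ q) −
  λ·expMul λ q`), `expMul_zero_seq`; THE SHIFT INTERTWINER **`hkFun_X_sub_C_mul_expMul`** (`⟪(X − λ)·p, expMul λ q⟫_s = ⟪p, expMul λ (σq)⟫_s`), **`hkFun_X_sub_C_pow_mul_expMul`** (`(X − λ)^j`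
  vs `σ^j`); `hankelShift_iterate_apply`, `hankelShift_iterate_eq_zero_of_order`, `natDegree_X_sub_C_pow'`; **`X_sub_C_pow_mem_recSpace_expMul`** (order `≤ P ⇒ (X − λ)^{P+1} ∈ Rec_{P+1}(expMul λ q)`,
  every `N`, every `λ`).
* §473 `prod_mem_recSpace_sum` (N18's product law over a finite family: `Π_i m_i ∈ Rec_{Σ r_i}(Σ q_i)`), `natDegree_divisorPoly` (`= D`), `divisorPoly_ne_zero` (N7's `sum_expMul_eq` reused);
  **`divisorPoly_mem_recSpace`** (`Π_i (X − λ_i)^{P_i+1} ∈ Rec_D(Σ_i expMul λ_i q_i)`, orders `≤ P_i`, ANY nodes, every `N`); then for DISTINCT nodes and EXACT orders (F2a):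
  **`recSpace_divisor_eq_bot`** (`k < D`, `D + k ≤ N + 1 ⇒ Rec_k = 0`), `rank_hankel1_half_divisor` (`2D ≤ N + 1 ⇒ R = D`), **`recSpace_divisor_eq_map_mulRight`** (`2D + d ≤ N + 1 ⇒
  Rec_{D+d} = Π_i (X − λ_i)^{P_i+1} · K[X]_{≤ d}`), **`recSpace_divisor_self_eq_span`** (`2D ≤ N + 1 ⇒ Rec_D = K · Π_i (X − λ_i)^{P_i+1}`), **`mem_recSpace_divisor_iff_dvd`** (`D + k ≤ N + 1`:
  `p ∈ Rec_k ↔ deg p ≤ k ∧ Π_i (X − λ_i)^{P_i+1} ∣ p`, every `k`).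
* §474 `roots_divisorPoly` (`roots = Σ_i (P_i + 1)·{λ_i}`), **`roots_eq_of_mem_recSpace_divisor`** (`2D ≤ N + 1`: every non-zero minimal recurrence has exactly these roots with
  multiplicity), **`rootMultiplicity_eq_of_mem_recSpace_divisor`** (`rootMultiplicity λ_i m = P_i + 1`).
READING: N19 (secant classes: all `P_i = 0`) by a Vandermonde minor; here the general divisor class by an OPERATOR identity (`σ − λ` intertwines `exp(λΘ)`) plus N18's product law
and dimension count — the minimal recurrence of a class supported on a divisor of the rational normal curve IS that divisor (nodes = roots, orders = multiplicities − 1), readable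
from `2D ≤ N + 1` coefficients; N4/N7's osculating flats are its column-space shadow.  Nothing Ext-side.  New names only.
-/

open Module Polynomial
open scoped Matrix Polynomial

namespace Summit.Ventures.HSemireg.Wedge.HankelOuter

open Summit.Ventures.HSemireg.Wedge Summit.Ventures.HSemireg.Wedge.Hankel Summit.Ventures.HSemireg.Wedge.HankelFrameChange

variable (K : Type*) [Field K] {N : ℕ}

/-! ## §472. The shift intertwiner: `⟪(X − λ)·p, exp(λΘ)v⟫ = ⟪p, exp(λΘ)·σv⟫` -/

/-- `⟪p, 0⟫_s = 0`. -/
@[simp] theorem hkFun_zero_seq (s : ℕ) (p : K[X]) : hkFun K (0 : ℕ → K) s p = 0 := by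
  rw [hkFun_apply]
  exact Finset.sum_eq_zero fun i _ => by simp only [Pi.zero_apply, mul_zero]

/-- `⟪p, σq⟫_s = ⟪p, q⟫_{s+1}`. -/
theorem hkFun_shift_seq (q : ℕ → K) (s : ℕ) (p : K[X]) : hkFun K (shift K q) s p = hkFun K q (s + 1) p := by
  rw [hkFun_apply, hkFun_apply]
  exact Finset.sum_congr rfl fun i _ => by simp only [shift_apply, add_assoc]

/-- `⟪(X − λ)·p, q⟫_s = ⟪p, q⟫_{s+1} − λ·⟪p, q⟫_s = ⟪p, (σ − λ) q⟫_s`. -/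
theorem hkFun_X_sub_C_mul (lam : K) (q : ℕ → K) (s : ℕ) (p : K[X]) :
    hkFun K q s ((Polynomial.X - Polynomial.C lam) * p) = hkFun K q (s + 1) p - lam * hkFun K q s p := by
  rw [sub_mul, map_sub, hkFun_X_mul, Polynomial.C_mul', map_smul, smul_eq_mul]

/-- the sequences: `expMul λ (σq) = σ(expMul λ q) − λ·expMul λ q` (the Pascal recursion read backwards). -/
theorem expMul_shift_eq (lam : K) (q : ℕ → K) : expMul K lam (shift K q) = shift K (expMul K lam q) + (-lam) • expMul K lam q := by
  funext j
  rw [Pi.add_apply, Pi.smul_apply, shift_expMul, smul_eq_mul]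
  ring

/-- `expMul λ 0 = 0`. -/
theorem expMul_zero_seq (lam : K) : expMul K lam (0 : ℕ → K) = 0 := by
  funext j
  induction j with
  | zero => rfl
  | succ j ih =>
    rw [Pi.zero_apply] at ih ⊢
    rw [expMul_succ, show shift K (0 : ℕ → K) = 0 from rfl, ih, mul_zero, add_zero]

/-- **THE SHIFT INTERTWINER: `⟪(X − λ)·p, expMul λ q⟫_s = ⟪p, expMul λ (σq)⟫_s`** (`σ − λ` on `exp(λΘ)v` is `exp(λΘ)σv`). -/
theorem hkFun_X_sub_C_mul_expMul (lam : K) (q : ℕ → K) (s : ℕ) (p : K[X]) :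
    hkFun K (expMul K lam q) s ((Polynomial.X - Polynomial.C lam) * p) = hkFun K (expMul K lam (shift K q)) s p := by
  rw [hkFun_X_sub_C_mul, expMul_shift_eq, hkFun_add_seq, hkFun_smul_seq, hkFun_shift_seq]
  ring

/-- iterated: `⟪(X − λ)^j·p, expMul λ q⟫_s = ⟪p, expMul λ (σ^j q)⟫_s`. -/
theorem hkFun_X_sub_C_pow_mul_expMul (lam : K) (j : ℕ) (q : ℕ → K) (s : ℕ) (p : K[X]) :
    hkFun K (expMul K lam q) s ((Polynomial.X - Polynomial.C lam) ^ j * p) = hkFun K (expMul K lam ((shift K)^[j] q)) s p := by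
  induction j generalizing q with
  | zero => rw [pow_zero, one_mul, Function.iterate_zero, id]
  | succ j ih => rw [pow_succ', mul_assoc, hkFun_X_sub_C_mul_expMul, ih, Function.iterate_succ_apply]

omit [Field K] in
/-- `(σ^j q)_t = q_{t+j}`. -/
theorem hankelShift_iterate_apply (j : ℕ) (q : ℕ → K) (t : ℕ) : (shift K)^[j] q t = q (t + j) := by
  induction j generalizing q with
  | zero => rfl
  | succ j ih => rw [Function.iterate_succ_apply, ih, shift_apply, show t + j + 1 = t + (j + 1) by omega]

/-- a sequence of order `P` dies under `σ^{P+1}`. -/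
theorem hankelShift_iterate_eq_zero_of_order {P : ℕ} {q : ℕ → K} (hq : ∀ j, P < j → q j = 0) : (shift K)^[P + 1] q = 0 := by
  funext t
  rw [hankelShift_iterate_apply, Pi.zero_apply]
  exact hq _ (by omega)

/-- `natDegree (X − λ)^m = m`, and it is non-zero. -/
theorem natDegree_X_sub_C_pow' (lam : K) (m : ℕ) : ((Polynomial.X - Polynomial.C lam) ^ m).natDegree = m := by
  rw [(Polynomial.monic_X_sub_C lam).natDegree_pow, Polynomial.natDegree_X_sub_C, mul_one]

/-- **THE NODE POWER IS A RECURRENCE: `(X − λ)^{P+1} ∈ Rec_{P+1}(expMul λ q)` whenever `q` has order `≤ P`** (every `N`, every `λ`; quoted: `(σ − λ)^{P+1}` kills `exp(λΘ)·(polynomial of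
degree `≤ P` in `Θ`)`). -/
theorem X_sub_C_pow_mem_recSpace_expMul (lam : K) {P : ℕ} {q : ℕ → K} (hq : ∀ j, P < j → q j = 0) :
    (Polynomial.X - Polynomial.C lam) ^ (P + 1) ∈ recSpace K N (expMul K lam q) (P + 1) := by
  rw [mem_recSpace_iff]
  refine ⟨(mem_degreeLT_succ_iff K).mpr (natDegree_X_sub_C_pow' K lam (P + 1)).le, fun s _ => ?_⟩
  rw [← mul_one ((Polynomial.X - Polynomial.C lam) ^ (P + 1)), hkFun_X_sub_C_pow_mul_expMul, hankelShift_iterate_eq_zero_of_order K hq, expMul_zero_seq, hkFun_zero_seq]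

/-! ## §473. The divisor polynomial `Π_i (X − λ_i)^{P_i+1}` is THE minimal recurrence of the divisor class `Σ_i exp(λ_i Θ) v_i` -/

/-- a product of recurrences of the summands is a recurrence of the sum (N18's product law, over a finite family). -/
theorem prod_mem_recSpace_sum {ι : Type*} (s : Finset ι) (m : ι → K[X]) (r : ι → ℕ) (qs : ι → ℕ → K)
    (h : ∀ i ∈ s, m i ∈ recSpace K N (qs i) (r i)) : (∏ i ∈ s, m i) ∈ recSpace K N (∑ i ∈ s, qs i) (∑ i ∈ s, r i) := by
  classical
  induction s using Finset.induction_on with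
  | empty =>
    rw [Finset.prod_empty, Finset.sum_empty, Finset.sum_empty, mem_recSpace_iff]
    exact ⟨(mem_degreeLT_succ_iff K).mpr (by rw [Polynomial.natDegree_one]), fun s _ => by rw [hkFun_zero_seq]⟩
  | insert a s ha ih =>
    rw [Finset.prod_insert ha, Finset.sum_insert ha, Finset.sum_insert ha]
    exact mul_mem_recSpace_add_seq K (h a (Finset.mem_insert_self a s)) (ih fun i hi => h i (Finset.mem_insert_of_mem hi))

/-- the DIVISOR POLYNOMIAL `Π_i (X − λ_i)^{P_i + 1}` has degree `D = Σ_i (P_i + 1)` … -/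
theorem natDegree_divisorPoly {r : ℕ} (lam : Fin r → K) (P : Fin r → ℕ) :
    (∏ i, (Polynomial.X - Polynomial.C (lam i)) ^ (P i + 1)).natDegree = ∑ i, (P i + 1) := by
  rw [Polynomial.natDegree_prod_of_monic _ _ fun i _ => (Polynomial.monic_X_sub_C (lam i)).pow _]
  exact Finset.sum_congr rfl fun i _ => natDegree_X_sub_C_pow' K (lam i) _

/-- … and is non-zero. -/
theorem divisorPoly_ne_zero {r : ℕ} (lam : Fin r → K) (P : Fin r → ℕ) : (∏ i, (Polynomial.X - Polynomial.C (lam i)) ^ (P i + 1)) ≠ 0 :=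
  (Polynomial.monic_prod_of_monic _ _ fun i _ => (Polynomial.monic_X_sub_C (lam i)).pow _).ne_zero

/-- **THE DIVISOR POLYNOMIAL IS A RECURRENCE OF THE DIVISOR CLASS: `Π_i (X − λ_i)^{P_i+1} ∈ Rec_D(Σ_i expMul λ_i q_i)`, `D = Σ_i (P_i + 1)`** (orders `≤ P_i`; every `N`, any nodes). -/
theorem divisorPoly_mem_recSpace {r : ℕ} (lam : Fin r → K) {P : Fin r → ℕ} {q : Fin r → ℕ → K} (hq : ∀ i j, P i < j → q i j = 0) :
    (∏ i, (Polynomial.X - Polynomial.C (lam i)) ^ (P i + 1)) ∈ recSpace K N (fun j => ∑ i, expMul K (lam i) (q i) j) (∑ i, (P i + 1)) := by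
  rw [sum_expMul_eq]
  exact prod_mem_recSpace_sum K Finset.univ _ _ _ fun i _ => X_sub_C_pow_mem_recSpace_expMul K (lam i) (hq i)

/-- **no recurrence of window `≤ D`: `Rec_k(Σ_i expMul λ_i q_i) = 0` for `k < D ≤ N + 1 − k`** (distinct nodes, exact orders `P_i`; F2a's divisor rank law). -/
theorem recSpace_divisor_eq_bot {r : ℕ} {lam : Fin r → K} (hlam : Function.Injective lam) {P : Fin r → ℕ} {q : Fin r → ℕ → K}
    (hq : ∀ i j, P i < j → q i j = 0) (hqP : ∀ i, q i (P i) ≠ 0) {k : ℕ} (hk : k < ∑ i, (P i + 1)) (hkD : (∑ i, (P i + 1)) + k ≤ N + 1) :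
    recSpace K N (fun j => ∑ i, expMul K (lam i) (q i) j) k = ⊥ := by
  have h := finrank_recSpace_add_rank K (N := N) k (fun j => ∑ i, expMul K (lam i) (q i) j)
  rw [rank_hankel1_expMul_sum_eq_min K hlam hq hqP (by omega), min_eq_right (by omega)] at h
  haveI := finiteDimensional_recSpace K (N := N) (fun j => ∑ i, expMul K (lam i) (q i) j) k
  exact Submodule.finrank_eq_zero.mp (by omega)

/-- the middle rank of the divisor class is its degree: `R(Σ_i expMul λ_i q_i) = D` for `2D ≤ N + 1`. -/
theorem rank_hankel1_half_divisor {r : ℕ} {lam : Fin r → K} (hlam : Function.Injective lam) {P : Fin r → ℕ} {q : Fin r → ℕ → K}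
    (hq : ∀ i j, P i < j → q i j = 0) (hqP : ∀ i, q i (P i) ≠ 0) (h2D : (∑ i, (P i + 1)) + (∑ i, (P i + 1)) ≤ N + 1) :
    (hankel1 K N (N / 2) (fun j => ∑ i, expMul K (lam i) (q i) j)).rank = ∑ i, (P i + 1) := by
  rw [rank_hankel1_expMul_sum_eq_min K hlam hq hqP (by omega), min_eq_left (by omega)]

/-- **GENERALISED PRONY (module form): for distinct nodes, exact orders `P_i`, `D = Σ_i (P_i + 1)` and `2D + d ≤ N + 1`,
`Rec_{D+d}(Σ_i expMul λ_i q_i) = Π_i (X − λ_i)^{P_i+1} · K[X]_{≤ d}`.** -/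
theorem recSpace_divisor_eq_map_mulRight {r : ℕ} {lam : Fin r → K} (hlam : Function.Injective lam) {P : Fin r → ℕ} {q : Fin r → ℕ → K}
    (hq : ∀ i j, P i < j → q i j = 0) (hqP : ∀ i, q i (P i) ≠ 0) {d : ℕ} (hd : (∑ i, (P i + 1)) + d + (∑ i, (P i + 1)) ≤ N + 1) :
    recSpace K N (fun j => ∑ i, expMul K (lam i) (q i) j) ((∑ i, (P i + 1)) + d)
      = (Polynomial.degreeLT K (d + 1)).map (LinearMap.mulRight K (∏ i, (Polynomial.X - Polynomial.C (lam i)) ^ (P i + 1))) :=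
  recSpace_eq_map_mulRight K (rank_hankel1_half_divisor K hlam hq hqP (by omega)) hd (divisorPoly_mem_recSpace K lam hq) (divisorPoly_ne_zero K lam P)

/-- **THE MINIMAL RECURRENCE OF A DIVISOR CLASS IS ITS DIVISOR POLYNOMIAL: `Rec_D(Σ_i expMul λ_i q_i) = K · Π_i (X − λ_i)^{P_i+1}`** for `2D ≤ N + 1`. -/
theorem recSpace_divisor_self_eq_span {r : ℕ} {lam : Fin r → K} (hlam : Function.Injective lam) {P : Fin r → ℕ} {q : Fin r → ℕ → K}
    (hq : ∀ i j, P i < j → q i j = 0) (hqP : ∀ i, q i (P i) ≠ 0) (h2D : (∑ i, (P i + 1)) + (∑ i, (P i + 1)) ≤ N + 1) :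
    recSpace K N (fun j => ∑ i, expMul K (lam i) (q i) j) (∑ i, (P i + 1)) = K ∙ ∏ i, (Polynomial.X - Polynomial.C (lam i)) ^ (P i + 1) := by
  haveI := finiteDimensional_recSpace K (N := N) (fun j => ∑ i, expMul K (lam i) (q i) j) (∑ i, (P i + 1))
  symm
  refine Submodule.eq_of_le_of_finrank_eq ((Submodule.span_singleton_le_iff_mem _ _).mpr (divisorPoly_mem_recSpace K lam hq)) ?_
  rw [finrank_span_singleton (divisorPoly_ne_zero K lam P), finrank_recSpace_self K (rank_hankel1_half_divisor K hlam hq hqP h2D) h2D]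

/-- **GENERALISED PRONY (divisibility form): for `D + k ≤ N + 1`, `p ∈ Rec_k(Σ_i expMul λ_i q_i)` iff `deg p ≤ k` and `Π_i (X − λ_i)^{P_i+1} ∣ p`** — the divisor polynomial
divides every recurrence inside the window (and nothing of degree `< D` is a recurrence). -/
theorem mem_recSpace_divisor_iff_dvd {r : ℕ} {lam : Fin r → K} (hlam : Function.Injective lam) {P : Fin r → ℕ} {q : Fin r → ℕ → K}
    (hq : ∀ i j, P i < j → q i j = 0) (hqP : ∀ i, q i (P i) ≠ 0) {k : ℕ} (hk : (∑ i, (P i + 1)) + k ≤ N + 1) {p : K[X]} :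
    p ∈ recSpace K N (fun j => ∑ i, expMul K (lam i) (q i) j) k
      ↔ p ∈ Polynomial.degreeLT K (k + 1) ∧ (∏ i, (Polynomial.X - Polynomial.C (lam i)) ^ (P i + 1)) ∣ p := by
  set D := ∑ i, (P i + 1) with hD
  set m := ∏ i, (Polynomial.X - Polynomial.C (lam i)) ^ (P i + 1) with hm
  have hmdeg : m.natDegree = D := natDegree_divisorPoly K lam P
  have hm0 : m ≠ 0 := divisorPoly_ne_zero K lam P
  rcases Nat.lt_or_ge k D with hlt | hle
  · rw [recSpace_divisor_eq_bot K hlam hq hqP hlt hk, Submodule.mem_bot]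
    constructor
    · rintro rfl
      exact ⟨Submodule.zero_mem _, dvd_zero m⟩
    · rintro ⟨hdeg, hdvd⟩
      by_contra hne
      have h1 := Polynomial.natDegree_le_of_dvd hdvd hne
      have h2 := (mem_degreeLT_succ_iff K).mp hdeg
      omega
  · obtain ⟨d, rfl⟩ := Nat.exists_eq_add_of_le hle
    rw [recSpace_divisor_eq_map_mulRight K hlam hq hqP (by omega), Submodule.mem_map]
    constructor
    · rintro ⟨g, hg, rfl⟩
      refine ⟨?_, Dvd.intro_left g rfl⟩
      rw [LinearMap.mulRight_apply]
      by_cases hg0 : g = 0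
      · rw [hg0, zero_mul]; exact Submodule.zero_mem _
      · have := (mem_degreeLT_succ_iff K).mp hg
        exact (mem_degreeLT_succ_iff K).mpr (by rw [Polynomial.natDegree_mul hg0 hm0]; omega)
    · rintro ⟨hdeg, g, rfl⟩
      refine ⟨g, ?_, by rw [LinearMap.mulRight_apply, mul_comm]⟩
      by_cases hg0 : g = 0
      · rw [hg0]; exact Submodule.zero_mem _
      · have h1 := (mem_degreeLT_succ_iff K).mp hdeg
        rw [Polynomial.natDegree_mul hm0 hg0] at h1
        exact (mem_degreeLT_succ_iff K).mpr (by omega)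

/-! ## §474. The nodes AND the orders are read off the minimal recurrence: its roots with multiplicities are the divisor -/

/-- the roots of the divisor polynomial, with multiplicity: `Σ_i (P_i + 1)·{λ_i}`. -/
theorem roots_divisorPoly {r : ℕ} (lam : Fin r → K) (P : Fin r → ℕ) :
    (∏ i, (Polynomial.X - Polynomial.C (lam i)) ^ (P i + 1)).roots = ∑ i, (P i + 1) • ({lam i} : Multiset K) := by
  rw [Polynomial.roots_prod _ _ (divisorPoly_ne_zero K lam P), Finset.sum_eq_multiset_sum]
  simp only [Polynomial.roots_pow, Polynomial.roots_X_sub_C, Multiset.bind, Multiset.join]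

/-- **PRONY WITH MULTIPLICITIES: for `2D ≤ N + 1`, every non-zero minimal recurrence `m ∈ Rec_D(Σ_i expMul λ_i q_i)` has `m.roots = Σ_i (P_i + 1)·{λ_i}`** — the nodes are its roots
and the orders `P_i` are the root multiplicities minus one. -/
theorem roots_eq_of_mem_recSpace_divisor {r : ℕ} {lam : Fin r → K} (hlam : Function.Injective lam) {P : Fin r → ℕ} {q : Fin r → ℕ → K}
    (hq : ∀ i j, P i < j → q i j = 0) (hqP : ∀ i, q i (P i) ≠ 0) (h2D : (∑ i, (P i + 1)) + (∑ i, (P i + 1)) ≤ N + 1) {m : K[X]}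
    (hm : m ∈ recSpace K N (fun j => ∑ i, expMul K (lam i) (q i) j) (∑ i, (P i + 1))) (hm0 : m ≠ 0) :
    m.roots = ∑ i, (P i + 1) • ({lam i} : Multiset K) := by
  rw [recSpace_divisor_self_eq_span K hlam hq hqP h2D, Submodule.mem_span_singleton] at hm
  obtain ⟨c, rfl⟩ := hm
  have hc : c ≠ 0 := by rintro rfl; exact hm0 (zero_smul _ _)
  rw [Polynomial.roots_smul_nonzero _ hc, roots_divisorPoly]

/-- in particular **the root multiplicity of `λ_i` in the minimal recurrence is `P_i + 1`** (distinct nodes). -/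
theorem rootMultiplicity_eq_of_mem_recSpace_divisor [DecidableEq K] {r : ℕ} {lam : Fin r → K} (hlam : Function.Injective lam) {P : Fin r → ℕ}
    {q : Fin r → ℕ → K} (hq : ∀ i j, P i < j → q i j = 0) (hqP : ∀ i, q i (P i) ≠ 0) (h2D : (∑ i, (P i + 1)) + (∑ i, (P i + 1)) ≤ N + 1)
    {m : K[X]} (hm : m ∈ recSpace K N (fun j => ∑ i, expMul K (lam i) (q i) j) (∑ i, (P i + 1))) (hm0 : m ≠ 0) (i : Fin r) :
    m.rootMultiplicity (lam i) = P i + 1 := by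
  rw [← Polynomial.count_roots, roots_eq_of_mem_recSpace_divisor K hlam hq hqP h2D hm hm0, Multiset.count_sum']
  rw [Finset.sum_eq_single i]
  · rw [Multiset.count_nsmul, Multiset.count_singleton_self, mul_one]
  · intro j _ hji
    rw [Multiset.count_nsmul, Multiset.count_singleton, if_neg (fun h => hji (hlam h.symm)), mul_zero]
  · intro h; exact absurd (Finset.mem_univ i) h

end Summit.Ventures.HSemireg.Wedge.HankelOuter
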